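import Literature.AlgebraicGeometry.Resolution.AlterationsProofs
import Literature.AlgebraicGeometry.Resolution.StrictNormalCrossings
import Literature.AlgebraicGeometry.Resolution.ChowLemmaProofs
import Literature.AlgebraicGeometry.Motives.VarietiesDimensionProofs
import Mathlib.FieldTheory.IsAlgClosed.Basic
import Mathlib.FieldTheory.PerfectClosure
import Mathlib.AlgebraicGeometry.Morphisms.Etale
import Mathlib.RingTheory.Jacobson.Ring
import HarnessLib

/-!
# De Jong's alteration theorem, strong form (Thm. 4.1 (i)+(ii)) and the skeleton of its proof

Topic: `Literature/AlgebraicGeometry/Resolution`. Third companion to `Alterations.lean`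
(`DeJong1996`, weak form) and `AlterationsProofs.lean` (`DeJong1996Projective`, conclusion (i)),
working towards `DeJong1996Projective_holds`. The printed proof of de Jong 1996, Thm. 4.1
(loc. cit. 4.3–4.28) is an induction on `d = dim X` of the STRONG statement — conclusion (ii),
the strict normal crossings boundary, is what the induction hypothesis is used for in 4.22 — so
any assembly of `DeJong1996Projective` must pass through the strong statement. This file

* vendors Thm. 4.1 in full, (i) and (ii), as the named fact `DeJong1996Strong`, with its last
  sentence (the generically-étale refinement over perfect fields, 2.6 = `IsGenericallyEtale`) as
  `DeJong1996StrongPerfect`, using `IsStrictNormalCrossingsDivisor` (`StrictNormalCrossings.lean`,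
  de Jong 1996, 2.4), and proves `DeJong1996Strong → DeJong1996Projective (→ DeJong1996)`;
* proves the bookkeeping steps of the printed proof: 4.3 (the case `dim X = 0`: `X ≅ Spec K`
  with `K/k` finite is its own regular projective compactification, `Z = ∅`, and `𝟙` is
  generically étale) and 4.4 (replacing `(X, Z)` by `(X', φ⁻¹Z)` along an alteration `φ`,
  "generically étale in case `k` is perfect": generically étale alterations compose);
* vendors the two remaining blocks of the printed proof as named facts with the source's
  numbering. Over the algebraically closed field of the induction the printed argument proves,
  and in 4.15/4.22 USES, Thm. 4.1 together with the generically-étale clause, so the inductive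
  statement `DeJong1996.StatementUpToDim k d` carries that clause
  (`DeJong1996.ConclusionGenericallyEtale`): `DeJong1996Descent` (4.5: the statement over
  algebraically closed fields gives `DeJong1996Strong` for all `k` and `DeJong1996StrongPerfect`
  for perfect `k`) and `DeJong1996InductionStep` (4.6–4.28: the induction step over an
  algebraically closed field, i.e. Chow's lemma and projective compactification 4.6–4.7, blowing up `Z` and normalising
  4.8–4.10, the Lefschetz-pencil Lemma 4.11 and Stein factorisation 4.12, the multisection
  Lemma 4.13–4.14, Galois normalisation of the base 4.15–4.16, extension of the moduli map to the
  projective level-`ℓ` moduli scheme of stable pointed curves 4.17 (2.24), flattening (2.19) and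
  the three-point Lemma 4.18–4.21, the induction hypothesis for `(Y, D)` 4.22, and the explicit
  resolution of split semi-stable families over a normal crossings base 4.23–4.28 with §3) —
  and proves the assembly
  `DeJong1996Descent → DeJong1996InductionStep → DeJong1996Strong ∧ DeJong1996StrongPerfect`
  (hence `→ DeJong1996Projective`) by induction on the dimension, using that a scheme of finite
  type over a field has finite dimension (`exists_topologicalKrullDim_le_of_locallyOfFiniteType`,
  proved here).

The two named facts are the nodes to be decomposed further (each is a theory: moduli of stable
curves, flattening by blowing up, semi-stable resolution); `NOTES` of the owning literature unit
keep the DAG.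

## Sources

* A. J. de Jong, *Smoothness, semi-stability and alterations*, Publ. Math. IHÉS 83 (1996) 51–93:
  2.6 (generically étale), 2.9 (variety), 2.20 (alteration), Thm. 4.1 and Remark 4.2 (p. 66),
  4.3, 4.4, 4.5 (p. 66), 4.6–4.28 (pp. 66–76), §3 (pp. 62–65), 2.19, 2.24 (pp. 60–62).
* The Stacks Project, Tag 0CY7 (Zariski's lemma / Hilbert Nullstellensatz: a field of finite type
  over a field is finite over it), Tag 01TB (finite type over a field and dimension).
-/

noncomputable section

open CategoryTheory AlgebraicGeometry TopologicalSpace Topology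

namespace Literature.AlgebraicGeometry.Resolution

universe u

/-! ## Generically étale morphisms (de Jong 1996, 2.6) -/

/-- **Generically étale** (de Jong 1996, 2.6): "Let `f : X → S` be a morphism of schemes. We say
that `f` is generically étale if there exists an open dense subscheme `U ⊂ X` such that `f|_U`
is étale." [cite: DeJong1996, 2.6, p. 55] -/
def IsGenericallyEtale {X S : Scheme.{u}} (f : X ⟶ S) : Prop :=
  ∃ U : X.Opens, Dense (U : Set X) ∧ Etale (U.ι ≫ f)

namespace IsGenericallyEtale

/-- An étale morphism (e.g. an open immersion, an isomorphism) is generically étale.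
[folklore] -/
theorem of_etale {X S : Scheme.{u}} (f : X ⟶ S) [Etale f] : IsGenericallyEtale f :=
  ⟨⊤, by simp, inferInstance⟩

/-- A morphism which is an isomorphism over an open of the target with dense preimage (e.g. a
modification as in Chow's lemma) is generically étale. [folklore] -/
theorem of_isIso_morphismRestrict {X S : Scheme.{u}} (f : X ⟶ S) (U : S.Opens)
    (hU : Dense ((f ⁻¹ᵁ U : X.Opens) : Set X)) [IsIso (f ∣_ U)] : IsGenericallyEtale f :=
  ⟨f ⁻¹ᵁ U, hU, by rw [← morphismRestrict_ι]; infer_instance⟩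

/-- **Generically étale morphisms compose** (used in de Jong 1996, 4.4: "Here we assume that `φ`
is generically étale in case `k` is perfect"): if `ψ : X'' → X'` is dominant with irreducible
source and `ψ`, `φ` are generically étale, so is `ψ ≫ φ` — it is étale on
`U'' ∩ ψ⁻¹(U')`, a non-empty (by dominance) hence dense open. [cite: DeJong1996, 4.4, p. 66] -/
theorem comp {X'' X' X : Scheme.{u}} {ψ : X'' ⟶ X'} {φ : X' ⟶ X} [IrreducibleSpace X'']
    [IsDominant ψ] (hψ : IsGenericallyEtale ψ) (hφ : IsGenericallyEtale φ) :
    IsGenericallyEtale (ψ ≫ φ) := by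
  obtain ⟨U'', hU'', hψU⟩ := hψ
  obtain ⟨U', hU', hφU⟩ := hφ
  haveI := hψU
  haveI := hφU
  -- the open `W = U'' ∩ ψ⁻¹(U')` is non-empty, hence dense
  let W : X''.Opens := U'' ⊓ ψ ⁻¹ᵁ U'
  haveI : Nonempty X' := ⟨ψ (Classical.arbitrary X'')⟩
  have hWne : (W : Set X'').Nonempty := by
    have h1 : ((ψ ⁻¹ᵁ U' : X''.Opens) : Set X'').Nonempty := by
      obtain ⟨x, hx⟩ := ψ.denseRange.exists_mem_open U'.isOpen hU'.nonempty
      exact ⟨x, hx⟩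
    obtain ⟨x, hx⟩ := h1
    obtain ⟨y, hyU, hyV⟩ := hU''.exists_mem_open (ψ ⁻¹ᵁ U').isOpen ⟨x, hx⟩
    exact ⟨y, hyU, hyV⟩
  refine ⟨W, W.isOpen.dense hWne, ?_⟩
  -- `W → X'` factors through `U'`, by an étale morphism
  have hWU' : Set.range (W.ι ≫ ψ) ⊆ Set.range U'.ι := by
    rintro _ ⟨w, rfl⟩
    rw [Scheme.Opens.range_ι]
    exact w.2.2
  let t : (W : Scheme.{u}) ⟶ U' := IsOpenImmersion.lift U'.ι (W.ι ≫ ψ) hWU'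
  have ht : t ≫ U'.ι = W.ι ≫ ψ := IsOpenImmersion.lift_fac _ _ _
  haveI : Etale (W.ι ≫ ψ) := by
    rw [show W.ι = X''.homOfLE (inf_le_left : W ≤ U'') ≫ U''.ι from (X''.homOfLE_ι _).symm,
      Category.assoc]
    infer_instance
  haveI : Etale t := by
    haveI : Etale (t ≫ U'.ι) := by rw [ht]; infer_instance
    exact Etale.of_comp t U'.ι
  rw [← Category.assoc, ← ht, Category.assoc]
  infer_instance

/-- Generic étaleness passes to the restriction over an open of the target. [folklore] -/
theorem morphismRestrict {X S : Scheme.{u}} {f : X ⟶ S} (hf : IsGenericallyEtale f)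
    (V : S.Opens) : IsGenericallyEtale (f ∣_ V) := by
  obtain ⟨U, hU, hfU⟩ := hf
  haveI := hfU
  refine ⟨(f ⁻¹ᵁ V).ι ⁻¹ᵁ U, hU.preimage (f ⁻¹ᵁ V).ι.isOpenEmbedding.isOpenMap, ?_⟩
  -- `((f⁻¹V) ∩ U → V) ≫ (V ⊆ S)` is `(… ⊆ U) ≫ U.ι ≫ f`, which is étale
  have : (((f ⁻¹ᵁ V).ι ⁻¹ᵁ U).ι ≫ f ∣_ V) ≫ V.ι =
      IsOpenImmersion.lift U.ι (((f ⁻¹ᵁ V).ι ⁻¹ᵁ U).ι ≫ (f ⁻¹ᵁ V).ι)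
        (by
          rintro _ ⟨w, rfl⟩
          rw [Scheme.Opens.range_ι]
          exact w.2) ≫ U.ι ≫ f := by
    rw [IsOpenImmersion.lift_fac_assoc, Category.assoc, Category.assoc, morphismRestrict_ι]
  haveI : Etale ((((f ⁻¹ᵁ V).ι ⁻¹ᵁ U).ι ≫ f ∣_ V) ≫ V.ι) := by
    rw [this]
    infer_instance
  exact Etale.of_comp _ V.ι

/-- Generic étaleness is preserved by composing with an isomorphism on the right. [folklore] -/
theorem comp_iso {X S T : Scheme.{u}} {f : X ⟶ S} (hf : IsGenericallyEtale f) (e : S ⟶ T)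
    [IsIso e] : IsGenericallyEtale (f ≫ e) := by
  obtain ⟨U, hU, hfU⟩ := hf
  haveI := hfU
  exact ⟨U, hU, by rw [← Category.assoc]; infer_instance⟩

end IsGenericallyEtale

/-! ## The conclusion of Theorem 4.1 for a pair `(X → Spec k, Z)` -/

namespace DeJong1996

/-- The conclusion of de Jong 1996, Thm. 4.1 for the pair `(X → Spec k, Z)`: "There exist an
alteration `φ₁ : X₁ → X` and an open immersion `j₁ : X₁ → X̄₁` such that (i) `X̄₁` is a projective
variety and is a regular scheme, and (ii) the closed subset `j₁(φ₁⁻¹(Z)) ∪ X̄₁ ∖ j₁(X₁)` is a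
strict normal crossings divisor in `X̄₁`", everything over `k` (`j₁ ≫ (X̄₁ → Spec k) = φ₁ ≫ f`);
"projective variety over `k`" = integral `k`-scheme with a closed `k`-immersion into some `ℙⁿ_k`
(`Literature.AlgebraicGeometry.Motives.IsProjectiveOver`), "regular" = `Scheme.IsRegular`, "strict normal crossings divisor" =
`IsStrictNormalCrossingsDivisor` (de Jong 1996, 2.4). [cite: DeJong1996, Thm. 4.1, p. 66] -/
def Conclusion {k : Type u} [Field k] {X : Scheme.{u}} (f : X ⟶ Spec (.of k)) (Z : Set X) :
    Prop :=
  ∃ (X₁ Xbar₁ : Scheme.{u}) (φ₁ : X₁ ⟶ X) (j₁ : X₁ ⟶ Xbar₁) (g : Xbar₁ ⟶ Spec (.of k)),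
    IsAlteration φ₁ ∧ IsOpenImmersion j₁ ∧ IsIntegral Xbar₁ ∧
      Literature.AlgebraicGeometry.Motives.IsProjectiveOver (Over.mk g) ∧ Scheme.IsRegular Xbar₁ ∧ j₁ ≫ g = φ₁ ≫ f ∧
        IsStrictNormalCrossingsDivisor Xbar₁ (j₁ '' (φ₁ ⁻¹' Z) ∪ (Set.range j₁)ᶜ)

/-- The conclusion of Thm. 4.1 together with its last sentence: the alteration `φ₁` is moreover
generically étale (de Jong 1996, 2.6, `IsGenericallyEtale`). This is what the printed proof
establishes over an algebraically closed field and what its induction hypothesis consumes (4.15,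
4.22). [cite: DeJong1996, Thm. 4.1, p. 66] -/
def ConclusionGenericallyEtale {k : Type u} [Field k] {X : Scheme.{u}} (f : X ⟶ Spec (.of k))
    (Z : Set X) : Prop :=
  ∃ (X₁ Xbar₁ : Scheme.{u}) (φ₁ : X₁ ⟶ X) (j₁ : X₁ ⟶ Xbar₁) (g : Xbar₁ ⟶ Spec (.of k)),
    IsAlteration φ₁ ∧ IsOpenImmersion j₁ ∧ IsIntegral Xbar₁ ∧
      Literature.AlgebraicGeometry.Motives.IsProjectiveOver (Over.mk g) ∧ Scheme.IsRegular Xbar₁ ∧ j₁ ≫ g = φ₁ ≫ f ∧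
        IsStrictNormalCrossingsDivisor Xbar₁ (j₁ '' (φ₁ ⁻¹' Z) ∪ (Set.range j₁)ᶜ) ∧
          IsGenericallyEtale φ₁

/-- Forgetting the generically-étale refinement. [folklore] -/
theorem ConclusionGenericallyEtale.conclusion {k : Type u} [Field k] {X : Scheme.{u}}
    {f : X ⟶ Spec (.of k)} {Z : Set X} (h : ConclusionGenericallyEtale f Z) :
    Conclusion f Z := by
  obtain ⟨X₁, Xbar₁, φ₁, j₁, g, h₁, h₂, h₃, h₄, h₅, h₆, h₇, -⟩ := h
  exact ⟨X₁, Xbar₁, φ₁, j₁, g, h₁, h₂, h₃, h₄, h₅, h₆, h₇⟩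

/-- Thm. 4.1 WITH the generically-étale clause for all pairs `(X, Z)` over the field `k` with
`dim X ≤ d`: the statement the printed induction on `d = dim X` (de Jong 1996, 4.3) proves over
an algebraically closed `k` and uses as induction hypothesis in 4.22 ("there exists a
nonsingular projective variety `Y'` and a generically étale alteration `ψ : Y' → Y` such that
…", needed in 4.15). [cite: DeJong1996, 4.3 and 4.22, pp. 66, 74] -/
def StatementUpToDim (k : Type u) [Field k] (d : ℕ) : Prop :=
  ∀ (X : Scheme.{u}) (f : X ⟶ Spec (.of k)) (Z : Set X),
    IsSeparated f → LocallyOfFiniteType f → QuasiCompact f → IsIntegral X →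
      topologicalKrullDim X ≤ d → IsClosed Z → Z ≠ Set.univ → ConclusionGenericallyEtale f Z

/-- `StatementUpToDim` is monotone decreasing in `d`. [folklore] -/
theorem StatementUpToDim.of_le {k : Type u} [Field k] {d d' : ℕ} (h : StatementUpToDim k d')
    (hd : d ≤ d') : StatementUpToDim k d :=
  fun X f Z hs hl hq hi hdim hZ hZ' =>
    h X f Z hs hl hq hi (hdim.trans (by exact_mod_cast hd)) hZ hZ'

end DeJong1996

/-! ## Theorem 4.1, strong form (named facts) -/

/-- NAMED FACT — **de Jong's alteration theorem** (de Jong 1996, Thm. 4.1, with 2.9 and 2.20),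
conclusions (i) AND (ii): "Let `X` be a variety over a field `k` [an integral separated
`k`-scheme of finite type] and let `Z ⊂ X` be a proper closed subset. There exist an alteration
`φ₁ : X₁ → X` and an open immersion `j₁ : X₁ → X̄₁` such that (i) `X̄₁` is a projective variety
and is a regular scheme, and (ii) the closed subset `j₁(φ₁⁻¹(Z)) ∪ X̄₁ ∖ j₁(X₁)` is a strict
normal crossings divisor in `X̄₁`." (The last sentence of the theorem, "If `k` is perfect then
the alteration `φ₁` may be chosen to be generically étale", is `DeJong1996StrongPerfect`;
Remark 4.2 — `X̄₁ → Spec k` factors through `Spec k₁`, `k ⊂ k₁` finite, with `X̄₁` geometrically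
irreducible and smooth over `k₁` — is not rendered.) Users take `(h : DeJong1996Strong)`.
[cite: DeJong1996, Thm. 4.1, p. 66] -/
def DeJong1996Strong : Prop :=
  ∀ (k : Type u) [Field k] (X : Scheme.{u}) (f : X ⟶ Spec (.of k)) (Z : Set X),
    IsSeparated f → LocallyOfFiniteType f → QuasiCompact f → IsIntegral X →
      IsClosed Z → Z ≠ Set.univ → DeJong1996.Conclusion f Z

/-- NAMED FACT — **de Jong's alteration theorem over a perfect field** (de Jong 1996, Thm. 4.1,
last sentence): for `k` perfect, in the situation of `DeJong1996Strong` "the alteration `φ₁`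
may be chosen to be generically étale" (2.6: étale on an open dense subscheme; 2.20: equivalently
`k(X) ⊂ k(X₁)` separable). Users take `(h : DeJong1996StrongPerfect)`.
[cite: DeJong1996, Thm. 4.1, p. 66] -/
def DeJong1996StrongPerfect : Prop :=
  ∀ (k : Type u) [Field k] [PerfectField k] (X : Scheme.{u}) (f : X ⟶ Spec (.of k))
    (Z : Set X), IsSeparated f → LocallyOfFiniteType f → QuasiCompact f → IsIntegral X →
      IsClosed Z → Z ≠ Set.univ → DeJong1996.ConclusionGenericallyEtale f Z

/-- Thm. 4.1, with its generically-étale clause (an algebraically closed field is perfect), for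
varieties over ALGEBRAICALLY CLOSED fields — hypothesis (i) of the printed proof (de Jong 1996,
4.5), under which 4.6–4.28 operate. [cite: DeJong1996, 4.5, p. 66] -/
def DeJong1996StrongAlgClosed : Prop :=
  ∀ (k : Type u) [Field k] [IsAlgClosed k] (X : Scheme.{u}) (f : X ⟶ Spec (.of k))
    (Z : Set X), IsSeparated f → LocallyOfFiniteType f → QuasiCompact f → IsIntegral X →
      IsClosed Z → Z ≠ Set.univ → DeJong1996.ConclusionGenericallyEtale f Z

/-! ## Elementary implications -/

/-- The perfect-field form specialises the strong form over perfect fields. [folklore] -/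
theorem DeJong1996StrongPerfect.conclusion (h : DeJong1996StrongPerfect.{u}) (k : Type u)
    [Field k] [PerfectField k] (X : Scheme.{u}) (f : X ⟶ Spec (.of k)) (Z : Set X)
    [IsSeparated f] [LocallyOfFiniteType f] [QuasiCompact f] [IsIntegral X] (hZ : IsClosed Z)
    (hZ' : Z ≠ Set.univ) : DeJong1996.Conclusion f Z :=
  (h k X f Z ‹_› ‹_› ‹_› ‹_› hZ hZ').conclusion

/-- The perfect-field form restricted to algebraically closed fields (which are perfect).
[folklore] -/
theorem DeJong1996StrongPerfect.algClosed (h : DeJong1996StrongPerfect.{u}) :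
    DeJong1996StrongAlgClosed.{u} :=
  fun k _ _ X f Z hs hl hq hi hZ hZ' => by
    haveI : PerfectField k := PerfectRing.toPerfectField k (ringExpChar k)
    exact h k X f Z hs hl hq hi hZ hZ'

/-- The perfect-field form gives `StatementUpToDim k d` for every perfect `k` and every `d`.
[folklore] -/
theorem DeJong1996StrongPerfect.statementUpToDim (h : DeJong1996StrongPerfect.{u}) (k : Type u)
    [Field k] [PerfectField k] (d : ℕ) : DeJong1996.StatementUpToDim k d :=
  fun X f Z hs hl hq hi _ hZ hZ' => h k X f Z hs hl hq hi hZ hZ'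

/-- **Strong form ⟹ projective form** (take `Z = ∅`, a proper closed subset since a variety is
non-empty, and forget (ii)). [cite: DeJong1996, Thm. 4.1, p. 66] -/
theorem DeJong1996Strong.projective (h : DeJong1996Strong.{u}) : DeJong1996Projective.{u} := by
  intro k _ X f hs hl hq hi
  have hne : (∅ : Set X) ≠ Set.univ := fun e =>
    (Set.univ_eq_empty_iff.mp e.symm).false (genericPoint X)
  obtain ⟨X₁, Xbar₁, φ₁, j₁, g, h₁, h₂, h₃, h₄, h₅, h₆, -⟩ := h k X f ∅ hs hl hq hi isClosed_empty hne
  exact ⟨X₁, Xbar₁, φ₁, j₁, g, h₁, h₂, h₃, h₄, h₅, h₆⟩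

/-- Strong form ⟹ weak form `DeJong1996` (an alteration with regular source). [folklore] -/
theorem DeJong1996Strong.deJong1996 (h : DeJong1996Strong.{u}) : DeJong1996.{u} :=
  h.projective.deJong1996

/-! ## 4.4: replacing `(X, Z)` by an alteration -/

/-- **de Jong 1996, 4.4 (strategy of proof)**: "if `φ : X' → X` is an alteration, put
`Z' = φ⁻¹(Z)`. If we can prove the theorem for the pair `(X', Z')`, then the theorem will follow
for the pair `(X, Z)`": compose the alteration `φ₁ : X₁ → X'` with `φ` (2.20, a composition of
alterations is an alteration) and keep `j₁ : X₁ → X̄₁`; the boundary is literally the same set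
since `φ₁⁻¹(φ⁻¹ Z) = (φ₁ ≫ φ)⁻¹ Z`. [cite: DeJong1996, 4.4, p. 66] -/
theorem DeJong1996.Conclusion.of_isAlteration {k : Type u} [Field k] {X' X : Scheme.{u}}
    [IsIntegral X] {f : X ⟶ Spec (.of k)} {Z : Set X} {φ : X' ⟶ X} (hφ : IsAlteration φ)
    (h : DeJong1996.Conclusion (φ ≫ f) (φ ⁻¹' Z)) : DeJong1996.Conclusion f Z := by
  obtain ⟨X₁, Xbar₁, φ₁, j₁, g, h₁, h₂, h₃, h₄, h₅, h₆, h₇⟩ := h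
  refine ⟨X₁, Xbar₁, φ₁ ≫ φ, j₁, g, h₁.comp hφ, h₂, h₃, h₄, h₅, by rw [h₆, Category.assoc], ?_⟩
  have : ((φ₁ ≫ φ) ⁻¹' Z : Set X₁) = φ₁ ⁻¹' (φ ⁻¹' Z) := by
    ext x
    simp only [Set.mem_preimage, Scheme.Hom.comp_apply]
  rwa [this]

/-- **de Jong 1996, 4.4 with the generically-étale clause** ("Here we assume that `φ` is
generically étale in case `k` is perfect"): if moreover `φ` and `φ₁` are generically étale, so
is `φ₁ ≫ φ` (`IsGenericallyEtale.comp`). [cite: DeJong1996, 4.4, p. 66] -/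
theorem DeJong1996.ConclusionGenericallyEtale.of_isAlteration {k : Type u} [Field k]
    {X' X : Scheme.{u}} [IsIntegral X] {f : X ⟶ Spec (.of k)} {Z : Set X} {φ : X' ⟶ X}
    (hφ : IsAlteration φ) (hφe : IsGenericallyEtale φ)
    (h : DeJong1996.ConclusionGenericallyEtale (φ ≫ f) (φ ⁻¹' Z)) :
    DeJong1996.ConclusionGenericallyEtale f Z := by
  obtain ⟨X₁, Xbar₁, φ₁, j₁, g, h₁, h₂, h₃, h₄, h₅, h₆, h₇, h₈⟩ := h
  haveI := h₁.isIntegral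
  haveI := h₁.isDominant
  refine ⟨X₁, Xbar₁, φ₁ ≫ φ, j₁, g, h₁.comp hφ, h₂, h₃, h₄, h₅, by rw [h₆, Category.assoc], ?_,
    h₈.comp hφe⟩
  have : ((φ₁ ≫ φ) ⁻¹' Z : Set X₁) = φ₁ ⁻¹' (φ ⁻¹' Z) := by
    ext x
    simp only [Set.mem_preimage, Scheme.Hom.comp_apply]
  rwa [this]

/-! ## 4.3: the case `dim X = 0` -/

section DimZero

variable {k : Type u} [Field k] {X : Scheme.{u}} (f : X ⟶ Spec (.of k))

/-- An integral scheme of dimension `≤ 0` is affine (it is any affine open neighbourhood of its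
unique point). [folklore] -/
theorem isAffine_of_topologicalKrullDim_le_zero [IsIntegral X] (hdim : topologicalKrullDim X ≤ 0) :
    IsAffine X := by
  obtain ⟨_, ⟨U, hU, rfl⟩, hηU, -⟩ := X.isBasis_affineOpens.exists_subset_of_mem_open
    (Set.mem_univ (genericPoint X)) isOpen_univ
  have hUtop : U = ⊤ := top_le_iff.mp fun x _ =>
    (eq_genericPoint_of_topologicalKrullDim_le_zero hdim x).symm ▸ hηU
  subst hUtop
  haveI : IsAffine (⊤ : X.Opens) := hU
  exact IsAffine.of_isIso X.topIso.inv

/-- On an integral scheme of dimension `≤ 0` every non-zero global section is a unit: its germ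
at the unique point (the generic point, whose local ring is the function field) is a unit.
[folklore] -/
theorem isField_of_topologicalKrullDim_le_zero [IsIntegral X] (hdim : topologicalKrullDim X ≤ 0) :
    IsField Γ(X, ⊤) := by
  refine ⟨⟨0, 1, zero_ne_one⟩, mul_comm, fun {s} hs => ?_⟩
  suffices h : IsUnit s from h.exists_right_inv
  apply X.toRingedSpace.isUnit_of_isUnit_germ ⊤ s
  intro x hx
  obtain rfl := eq_genericPoint_of_topologicalKrullDim_le_zero hdim x
  have hs' : X.presheaf.germ ⊤ (genericPoint X) hx s ≠ 0 := fun h0 =>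
    hs (germ_injective_of_isIntegral X (genericPoint X) hx (h0.trans (map_zero _).symm))
  exact Ne.isUnit hs'

/-- **An integral scheme of finite type over a field and of dimension `≤ 0` is finite over the
field** (it is `Spec K` with `K` a field of finite type, hence finite, over `k`: Zariski's lemma,
Stacks Tag 0CY7 / Tag 00FZ). [folklore] -/
theorem isFinite_of_topologicalKrullDim_le_zero [IsIntegral X] [LocallyOfFiniteType f]
    (hdim : topologicalKrullDim X ≤ 0) : IsFinite f := by
  haveI : IsAffine X := isAffine_of_topologicalKrullDim_le_zero hdim
  rw [HasAffineProperty.iff_of_isAffine (P := @IsFinite)]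
  refine ⟨inferInstance, ?_⟩
  -- `Γ(X)` as an algebra of finite type over `k`
  let ψ : k →+* Γ(X, ⊤) := f.appTop.hom.comp (Scheme.ΓSpecIso (.of k)).inv.hom
  have hψ : ψ.FiniteType := by
    have h1 : f.appTop.hom.FiniteType :=
      (HasRingHomProperty.iff_of_isAffine (P := @LocallyOfFiniteType)).mp ‹_›
    exact h1.comp (RingHom.FiniteType.of_surjective _
      (Scheme.ΓSpecIso (.of k)).symm.commRingCatIsoToRingEquiv.surjective)
  -- `Γ(X)` is a field, so it is finite over `k` (Zariski's lemma)
  have hψf : ψ.Finite := by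
    letI : Field Γ(X, ⊤) := (isField_of_topologicalKrullDim_le_zero hdim).toField
    letI : Algebra k Γ(X, ⊤) := ψ.toAlgebra
    haveI : Algebra.FiniteType k Γ(X, ⊤) := hψ
    exact finite_of_finite_type_of_isJacobsonRing k Γ(X, ⊤)
  have : f.appTop.hom = ψ.comp (Scheme.ΓSpecIso (.of k)).hom.hom := by
    dsimp only [ψ]
    rw [RingHom.comp_assoc, ← CommRingCat.hom_comp, Iso.hom_inv_id, CommRingCat.hom_id,
      RingHom.comp_id]
  rw [this]
  exact RingHom.Finite.comp hψf (RingHom.Finite.of_surjective _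
    (Scheme.ΓSpecIso (.of k)).commRingCatIsoToRingEquiv.surjective)

/-- An integral scheme of finite type over `k` of dimension `≤ 0` is projective over `k`: it is
affine of finite type, hence immerses into some `ℙⁿ_k` over `k`
(`ChowLemmaProof.exists_immersion_projectiveSpace`), and it is finite hence proper over `k`, so
the immersion is proper, hence a closed immersion. [folklore] -/
theorem isProjectiveOver_of_topologicalKrullDim_le_zero [IsIntegral X] [LocallyOfFiniteType f]
    (hdim : topologicalKrullDim X ≤ 0) : Literature.AlgebraicGeometry.Motives.IsProjectiveOver (Over.mk f) := by
  haveI : IsAffine X := isAffine_of_topologicalKrullDim_le_zero hdim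
  haveI : IsFinite f := isFinite_of_topologicalKrullDim_le_zero f hdim
  obtain ⟨n, ρ, hρ, hρf⟩ := ChowLemmaProof.exists_immersion_projectiveSpace k f
  haveI : IsProper (Motives.projectiveSpace n k).hom := Motives.isProper_projectiveSpace n k
  haveI : IsProper (ρ ≫ (Motives.projectiveSpace n k).hom) := by rw [hρf]; infer_instance
  haveI : IsProper ρ := IsProper.of_comp ρ (Motives.projectiveSpace n k).hom
  have hρc : IsClosedImmersion ρ := .of_isPreimmersion ρ ρ.isClosedMap.isClosed_range
  exact ⟨n, Over.homMk ρ hρf, hρc⟩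

/-- **de Jong 1996, 4.3, base of the induction: "The case `dim X = 0` is all right"**, for the
strong form. An integral `X` of finite type over `k` with `dim X = 0` is a point, regular
(`Scheme.IsRegular.of_topologicalKrullDim_le_zero`) and projective over `k`
(`isProjectiveOver_of_topologicalKrullDim_le_zero`); a proper closed subset `Z` is empty; so
`X₁ = X̄₁ = X`, `φ₁ = j₁ = 𝟙` solve the problem, with empty boundary.
[cite: DeJong1996, 4.3, p. 66] -/
theorem DeJong1996.conclusion_of_topologicalKrullDim_le_zero [IsIntegral X] [LocallyOfFiniteType f]
    (hdim : topologicalKrullDim X ≤ 0) {Z : Set X} (hZ : Z ≠ Set.univ) :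
    DeJong1996.Conclusion f Z := by
  have hZe : Z = ∅ := by
    obtain ⟨x, hx⟩ := (Set.ne_univ_iff_exists_notMem Z).mp hZ
    refine Set.eq_empty_iff_forall_notMem.mpr fun z hz => hx ?_
    rwa [eq_genericPoint_of_topologicalKrullDim_le_zero hdim x,
      ← eq_genericPoint_of_topologicalKrullDim_le_zero hdim z]
  subst hZe
  refine ⟨X, X, 𝟙 X, 𝟙 X, f, (isPurelyInseparableAlteration_id X).isAlteration, inferInstance,
    inferInstance, isProjectiveOver_of_topologicalKrullDim_le_zero f hdim,
    Scheme.IsRegular.of_topologicalKrullDim_le_zero hdim, rfl, ?_⟩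
  apply IsStrictNormalCrossingsDivisor.of_eq_empty
  simp

/-- 4.3 with the generically-étale clause: the identity is (generically) étale.
[cite: DeJong1996, 4.3, p. 66] -/
theorem DeJong1996.conclusionGenericallyEtale_of_topologicalKrullDim_le_zero [IsIntegral X]
    [LocallyOfFiniteType f] (hdim : topologicalKrullDim X ≤ 0) {Z : Set X}
    (hZ : Z ≠ Set.univ) : DeJong1996.ConclusionGenericallyEtale f Z := by
  have hZe : Z = ∅ := by
    obtain ⟨x, hx⟩ := (Set.ne_univ_iff_exists_notMem Z).mp hZ
    refine Set.eq_empty_iff_forall_notMem.mpr fun z hz => hx ?_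
    rwa [eq_genericPoint_of_topologicalKrullDim_le_zero hdim x,
      ← eq_genericPoint_of_topologicalKrullDim_le_zero hdim z]
  subst hZe
  refine ⟨X, X, 𝟙 X, 𝟙 X, f, (isPurelyInseparableAlteration_id X).isAlteration, inferInstance,
    inferInstance, isProjectiveOver_of_topologicalKrullDim_le_zero f hdim,
    Scheme.IsRegular.of_topologicalKrullDim_le_zero hdim, rfl, ?_, IsGenericallyEtale.of_etale _⟩
  apply IsStrictNormalCrossingsDivisor.of_eq_empty
  simp

/-- The base case packaged: `StatementUpToDim k 0` holds for every field `k`.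
[cite: DeJong1996, 4.3, p. 66] -/
theorem DeJong1996.statementUpToDim_zero (k : Type u) [Field k] :
    DeJong1996.StatementUpToDim k 0 :=
  fun X f _ _ hl _ hi hdim _ hZ' => by
    haveI := hl
    haveI := hi
    exact DeJong1996.conclusionGenericallyEtale_of_topologicalKrullDim_le_zero f
      (by exact_mod_cast hdim) hZ'

end DimZero

/-! ## Varieties are finite-dimensional -/

section FiniteDimension

variable {k : Type u} [Field k]

/-- The dimension of a scheme is bounded by the dimensions of the members of an open cover
(local rings do not change under open immersions, and `dim X = sup_x dim 𝒪_{X,x}`).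
[folklore] -/
theorem topologicalKrullDim_le_iSup_openCover {X : Scheme.{u}} (𝒰 : X.OpenCover) :
    topologicalKrullDim X ≤ ⨆ i, topologicalKrullDim (𝒰.X i) := by
  rw [Literature.AlgebraicGeometry.Motives.Scheme.topologicalKrullDim_eq_iSup_ringKrullDim_stalk]
  refine iSup_le fun x => ?_
  obtain ⟨y, hy⟩ := 𝒰.covers x
  have e := (asIso ((𝒰.f (𝒰.idx x)).stalkMap y)).commRingCatIsoToRingEquiv
  rw [← hy, ringKrullDim_eq_of_ringEquiv e]
  refine le_trans ?_ (le_iSup (fun i => topologicalKrullDim (𝒰.X i)) (𝒰.idx x))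
  rw [Literature.AlgebraicGeometry.Motives.Scheme.topologicalKrullDim_eq_iSup_ringKrullDim_stalk]
  exact le_iSup (fun z => ringKrullDim ((𝒰.X (𝒰.idx x)).presheaf.stalk z)) y

/-- An affine scheme of finite type over a field has dimension bounded by a natural number
(`Γ(X)` is a quotient of a polynomial ring `k[x₁, …, xₙ]`, of dimension `n`). [folklore] -/
theorem exists_topologicalKrullDim_le_of_isAffine {X : Scheme.{u}} [IsAffine X]
    (f : X ⟶ Spec (.of k)) [LocallyOfFiniteType f] :
    ∃ n : ℕ, topologicalKrullDim X ≤ n := by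
  let ψ : k →+* Γ(X, ⊤) := f.appTop.hom.comp (Scheme.ΓSpecIso (.of k)).inv.hom
  have hψ : ψ.FiniteType := by
    have h1 : f.appTop.hom.FiniteType :=
      (HasRingHomProperty.iff_of_isAffine (P := @LocallyOfFiniteType)).mp ‹_›
    exact h1.comp (RingHom.FiniteType.of_surjective _
      (Scheme.ΓSpecIso (.of k)).symm.commRingCatIsoToRingEquiv.surjective)
  letI : Algebra k Γ(X, ⊤) := ψ.toAlgebra
  haveI : Algebra.FiniteType k Γ(X, ⊤) := hψ
  obtain ⟨n, θ, hθ⟩ := Algebra.FiniteType.iff_quotient_mvPolynomial''.mp ‹Algebra.FiniteType k _›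
  refine ⟨n, ?_⟩
  have e : topologicalKrullDim X = topologicalKrullDim (PrimeSpectrum Γ(X, ⊤)) :=
    IsHomeomorph.topologicalKrullDim_eq _ X.isoSpec.hom.homeomorph.isHomeomorph
  rw [e, PrimeSpectrum.topologicalKrullDim_eq_ringKrullDim]
  refine (ringKrullDim_le_of_surjective θ.toRingHom hθ).trans ?_
  rw [MvPolynomial.ringKrullDim_of_isNoetherianRing, ringKrullDim_eq_zero_of_field]
  simp

/-- **A scheme of finite type over a field is finite-dimensional** (Stacks, Tag 01TB with 00OS):
cover by finitely many affine opens and bound each. [folklore] -/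
theorem exists_topologicalKrullDim_le_of_locallyOfFiniteType {X : Scheme.{u}}
    (f : X ⟶ Spec (.of k)) [LocallyOfFiniteType f] [CompactSpace X] :
    ∃ d : ℕ, topologicalKrullDim X ≤ d := by
  let 𝒰 := X.affineCover.finiteSubcover
  haveI : ∀ i, IsAffine (𝒰.X i) := fun i => by
    dsimp [𝒰, Scheme.OpenCover.finiteSubcover]
    infer_instance
  have hn : ∀ i, ∃ n : ℕ, topologicalKrullDim (𝒰.X i) ≤ n := fun i =>
    exists_topologicalKrullDim_le_of_isAffine (𝒰.f i ≫ f)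
  choose n hn using hn
  refine ⟨∑ i, n i, (topologicalKrullDim_le_iSup_openCover 𝒰).trans (iSup_le fun i => ?_)⟩
  refine (hn i).trans ?_
  exact_mod_cast Finset.single_le_sum (fun j _ => Nat.zero_le (n j)) (Finset.mem_univ i)

end FiniteDimension

/-! ## 4.5 and 4.6–4.28 as named facts; the assembly -/

/-- NAMED FACT — **de Jong 1996, 4.5: reduction to an algebraically closed ground field.**
"Let `k̄` be an algebraic closure of `k`. Let `X̄'` be an irreducible component of the scheme
`X ×_{Spec k} Spec k̄`, and let `Z̄'` be the inverse image of `Z` in `X̄'`. Suppose we can find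
`φ̄₁ : X̄₁ → X̄'` and `j̄₁` over `k̄` as in the theorem. There exists a finite extension `k₁` of `k`
contained in `k̄` such that [everything] exists over `k₁` […] If we put `φ₁ : X₁ → X` equal to
the composition of `φ₁'` with the natural morphism `X' ↪ X ⊗ k₁ → X` then the quadruple
`(X₁, X̄₁, φ₁, j₁)` is a solution to the problem posed in the theorem. […] Therefore it suffices
to prove the theorem under the additional hypothesis: (i) The field `k` is algebraically
closed." — with "(Note that if `φ̄₁` is generically étale then so is `φ₁'`, and if `k` is
perfect, then `X' → X` will be generically étale too.)" Vendored as that sufficiency: Thm. 4.1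
with its generically-étale clause over algebraically closed fields (`DeJong1996StrongAlgClosed`)
gives Thm. 4.1 over every field (`DeJong1996Strong`) and, with the clause, over every perfect
field (`DeJong1996StrongPerfect`). Users take `(h : DeJong1996Descent)`.
[cite: DeJong1996, 4.5, p. 66] -/
def DeJong1996Descent : Prop :=
  DeJong1996StrongAlgClosed.{u} → DeJong1996Strong.{u} ∧ DeJong1996StrongPerfect.{u}

/-- NAMED FACT — **de Jong 1996, 4.6–4.28: the induction step over an algebraically closed
field.** For `k` algebraically closed and `d : ℕ`: if Thm. 4.1 ((i), (ii) AND the generically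
étale clause, `DeJong1996.StatementUpToDim`) holds for all pairs `(Y, D)` over `k` with
`dim Y ≤ d`, then it holds for all pairs `(X, Z)` over `k` with `dim X ≤ d + 1` (the clause is
part of the induction: produced at each step, consumed in 4.15/4.22 — "we apply the induction
hypothesis: there exists a nonsingular projective variety `Y'` and a generically étale alteration
`ψ : Y' → Y` …"). This is the content of the printed proof from 4.6 to 4.28 (with Lemma 3.2,
3.5 and 2.11, 2.19, 2.24): Chow's lemma and projective compactification (4.6–4.7), blowing up
`Z` and normalising (4.8–4.10), the pencil Lemma 4.11 and Stein factorisation (4.12), the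
multisection Lemma 4.13 (4.14), base change along generically étale alterations of the base
(4.15), Galois normalisation making `Z` a union of sections (4.16), extension of the moduli map
through the projective level-`ℓ` moduli scheme of stable `n`-pointed curves (4.17), flattening
and the three-point Lemma 4.20 to extend `β : 𝒞 ⇢ X` (4.18–4.21), the induction hypothesis for
`(Y, D)` with `dim Y = dim X - 1` (4.22), and the explicit resolution of the resulting split
semi-stable curve over a regular base with normal crossings degeneracy divisor (4.23–4.28).
Users take `(h : DeJong1996InductionStep)`; it is the node to decompose further.
[cite: DeJong1996, 4.6–4.28, pp. 66–76] -/
def DeJong1996InductionStep : Prop :=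
  ∀ (k : Type u) [Field k] [IsAlgClosed k] (d : ℕ),
    DeJong1996.StatementUpToDim k d → DeJong1996.StatementUpToDim k (d + 1)

/-- Over an algebraically closed field, the base case 4.3 and the induction step 4.6–4.28 give
Thm. 4.1 (with its generically-étale clause) in every dimension. [cite: DeJong1996, 4.3, p. 66] -/
theorem DeJong1996.statementUpToDim_of_inductionStep (hstep : DeJong1996InductionStep.{u})
    (k : Type u) [Field k] [IsAlgClosed k] (d : ℕ) : DeJong1996.StatementUpToDim k d := by
  induction d with
  | zero => exact DeJong1996.statementUpToDim_zero k
  | succ d ih => exact hstep k d ih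

/-- The induction on `d = dim X` (de Jong 1996, 4.3) assembled over algebraically closed fields:
a variety has finite dimension, so some `StatementUpToDim k d` applies.
[cite: DeJong1996, 4.3, p. 66] -/
theorem DeJong1996StrongAlgClosed.of_inductionStep (hstep : DeJong1996InductionStep.{u}) :
    DeJong1996StrongAlgClosed.{u} := by
  intro k _ _ X f Z hs hl hq hi hZ hZ'
  haveI : CompactSpace X := (HasAffineProperty.iff_of_isAffine (P := @QuasiCompact)).mp hq
  obtain ⟨d, hd⟩ := exists_topologicalKrullDim_le_of_locallyOfFiniteType f
  exact DeJong1996.statementUpToDim_of_inductionStep hstep k d X f Z hs hl hq hi hd hZ hZ'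

/-- **Assembly of the printed proof of Thm. 4.1 from its two vendored blocks**: reduction to an
algebraically closed field (4.5) and the induction step (4.6–4.28), the base case (4.3) and the
bookkeeping being proved above. [cite: DeJong1996, 4.3–4.5, p. 66] -/
theorem DeJong1996Strong.of_descent_of_inductionStep (h45 : DeJong1996Descent.{u})
    (hstep : DeJong1996InductionStep.{u}) : DeJong1996Strong.{u} :=
  (h45 (DeJong1996StrongAlgClosed.of_inductionStep hstep)).1

/-- The same assembly delivers the last sentence of Thm. 4.1 (perfect ground fields).
[cite: DeJong1996, 4.3–4.5, p. 66] -/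
theorem DeJong1996StrongPerfect.of_descent_of_inductionStep (h45 : DeJong1996Descent.{u})
    (hstep : DeJong1996InductionStep.{u}) : DeJong1996StrongPerfect.{u} :=
  (h45 (DeJong1996StrongAlgClosed.of_inductionStep hstep)).2

/-- `DeJong1996Projective` from the two vendored blocks of the printed proof.
[cite: DeJong1996, Thm. 4.1, p. 66] -/
theorem DeJong1996Projective.of_descent_of_inductionStep (h45 : DeJong1996Descent.{u})
    (hstep : DeJong1996InductionStep.{u}) : DeJong1996Projective.{u} :=
  (DeJong1996Strong.of_descent_of_inductionStep h45 hstep).projective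

end Literature.AlgebraicGeometry.Resolution

end
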